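import Literature.Analysis.Complex.RootsOfUnityComplementRootContinuation
import Literature.NumberTheory.Automorphic.ModularLambdaRootTaylor
import Literature.Analysis.Complex.PullbackConvergence
import Literature.NumberTheory.Automorphic.UnboundedDenominatorsDimensionBoundProofs
import HarnessLib

/-!
# CDT Proposition 3.0.1, algebraization step: the pulled-back family is admissible (hypothesis (iii))

`Literature/Analysis/Complex/RootsOfUnityComplementAdmissibleFamily.lean` — PROOF-ONLY (no definition,
no named fact). Sequel of `RootsOfUnityComplementRootContinuation.lean` (continuation of a germ over the
universal covering of `ℂ ∖ μ_N`) and of `ModularLambdaRootTaylor.lean` (Taylor series of the analytic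
root `(λ(tᴺ)/16)^{1/N}` = CDT's formal uniformizer `x(t)`). F. Calegari, V. Dimitrov, Y. Tang, *The
unbounded denominators conjecture*, J. Amer. Math. Soc. 38 (2025), proof of Proposition 3.0.1:
"We use Theorem 2.0.1 with `U := ℂ ∖ 16^{-1/N}μ_N`, `p(x) := xᴺ` and `x := (λ(τ)/16)^{1/N} ∈ t + t²ℤ[1/N]⟦t⟧`
… on defining `x^* f` as the formal `x`-expansion of `f(q) = f(q(x))` … `φ(z) := 16^{-1/N} F_N(rz)`".

★ `exists_taylor_subst_eq_of_continuation` — the FORMAL-TO-ANALYTIC bridge for hypothesis (iii) of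
Theorem 2.0.1 as consumed by `CalegariDimitrovTang2025_unboundedDenominators.dim_le_unconditional`: let
`Φ = F_N` be the universal covering (based at `0`), `Ψ` the analytic root (`Ψ(0) = 0`, `Ψ′(0) = 1`,
`Ψᴺ = Λ₁₆(tᴺ)`), `F = 16^{1/N}Ψ` the competitor and `ω` its lift (`Φ ∘ ω = F`, `ω(0) = 0`); let `x` be
the formal root (`x ≡ t`, `xᴺ = L(tᴺ)`) and `f ∈ ℚ⟦x⟧` with `f(x(t)) = 𝓣H` for a germ `H` at `t = 0`;
if `y` is holomorphic on the unit disc with `y ∘ ω = H` near `0` (the output of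
`exists_holomorphic_extension_of_local_root_systems`), then for every `0 < r < 1` the function
`g := y(r ·)` is analytic about the closed unit disc and `f(𝓣φ) = 𝓣g` for `φ = 16^{-1/N} Φ(r ·)`.
Proof: near `0`, `Φ = F ∘ ω⁻¹`, so `φ = Ψ ∘ ω⁻¹ ∘ (r·)` and `g = H ∘ ω⁻¹ ∘ (r·)`; `𝓣Ψ = x`
(`taylorPowerSeries_root_eq_map_formal_root`), composition is substitution
(`taylorPowerSeries_comp`), and substitution is associative.

## References
* [CalegariDimitrovTang2025] F. Calegari, V. Dimitrov, Y. Tang, J. Amer. Math. Soc. 38 (2025), proof of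
  Proposition 3.0.1 (arXiv v1 Proposition 15, display (xt)).
-/

noncomputable section

open Set Metric Filter
open scoped Topology Manifold
open UpperHalfPlane hiding I

namespace Literature.Analysis.Complex

open _root_.Complex Literature.NumberTheory.Automorphic Literature.NumberTheory.Automorphic.ModularLambda

/-- ★ **The pulled-back family is admissible** (hypothesis (iii) of CDT Theorem 2.0.1 for the
family of Proposition 3.0.1, from the continuation `y` of the germ). See the module docstring.
[cite: CalegariDimitrovTang2025, Proposition 3.0.1 (proof)] -/
theorem exists_taylor_subst_eq_of_continuation {N : ℕ} (hN : 0 < N) {Φ : ℂ → ℂ}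
    (hΦ : DifferentiableOn ℂ Φ (ball (0 : ℂ) 1))
    -- the analytic root `Ψ = (λ(tᴺ)/16)^{1/N}` and the competitor `F = 16^{1/N} Ψ`
    {Ψ : ℂ → ℂ} (hΨd : DifferentiableOn ℂ Ψ (ball (0 : ℂ) 1)) (hΨ0 : Ψ 0 = 0) (hΨ1 : deriv Ψ 0 = 1)
    (hΨpow : ∀ z ∈ ball (0 : ℂ) 1,
      Ψ z ^ N = (cuspFunction 2 (fun τ : ℍ ↦ modularLambda τ / 16)) (z ^ N))
    -- the lift `ω` of `F` through `Φ`
    {ω : ℂ → ℂ} (hωd : DifferentiableOn ℂ ω (ball (0 : ℂ) 1)) (hω0 : ω 0 = 0)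
    (hΦω : ∀ t ∈ ball (0 : ℂ) 1, Φ (ω t) = (((16 : ℝ) ^ ((N : ℝ)⁻¹) : ℝ) : ℂ) * Ψ t)
    -- the formal root `x` and the formal expansion `f` of the modular function, `f(x(t)) = 𝓣H`
    {L : PowerSeries ℤ} (hL : qExpansion 2 (fun τ : ℍ ↦ modularLambda τ / 16) = L.map (Int.castRingHom ℂ))
    {x : PowerSeries ℚ} (hx0 : PowerSeries.constantCoeff x = 0) (hx1 : PowerSeries.coeff 1 x = 1)
    (hxN : x ^ N = PowerSeries.expand N hN.ne' (L.map (Int.castRingHom ℚ)))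
    {f : PowerSeries ℚ} {H : ℂ → ℂ} (hHan : AnalyticAt ℂ H 0)
    (hfH : (f.map (algebraMap ℚ ℂ)).subst (x.map (algebraMap ℚ ℂ)) =
      PowerSeries.mk fun n ↦ iteratedDeriv n H 0 / n.factorial)
    -- the continuation `y` of the germ `H ∘ ω⁻¹`
    {y : ℂ → ℂ} (hyd : DifferentiableOn ℂ y (ball (0 : ℂ) 1)) (hyω : ∀ᶠ t in 𝓝 0, y (ω t) = H t)
    {r : ℝ} (hr0 : 0 < r) (hr1 : r < 1) :
    ∃ g : ℂ → ℂ, AnalyticOnNhd ℂ g (closedBall 0 1) ∧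
      (f.map (algebraMap ℚ ℂ)).subst (PowerSeries.mk fun n ↦
          iteratedDeriv n (fun z : ℂ ↦ (((16 : ℝ) ^ (-(N : ℝ)⁻¹) : ℝ) : ℂ) * Φ ((r : ℂ) * z)) 0 /
            n.factorial) =
        PowerSeries.mk fun n ↦ iteratedDeriv n g 0 / n.factorial := by
  have hb : ball (0 : ℂ) 1 ∈ 𝓝 (0 : ℂ) := ball_mem_nhds _ one_pos
  have hb0 : (0 : ℂ) ∈ ball (0 : ℂ) 1 := mem_ball_self one_pos
  -- constants: `c = 16^{-1/N}`, `c · 16^{1/N} = 1`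
  set c : ℝ := (16 : ℝ) ^ (-(N : ℝ)⁻¹) with hc
  set c' : ℝ := (16 : ℝ) ^ ((N : ℝ)⁻¹) with hc'
  have hcc' : (c : ℂ) * (c' : ℂ) = 1 := by
    rw [← Complex.ofReal_mul, hc, hc', ← Real.rpow_add (by norm_num), neg_add_cancel, Real.rpow_zero,
      Complex.ofReal_one]
  -- `ω` is locally invertible at `0`
  have hωan : AnalyticAt ℂ ω 0 := hωd.analyticAt hb
  have hΨan : AnalyticAt ℂ Ψ 0 := hΨd.analyticAt hb
  have hω'0 : deriv ω 0 ≠ 0 := by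
    intro h0
    have hev : (fun t ↦ (c' : ℂ) * Ψ t) =ᶠ[𝓝 0] fun t ↦ Φ (ω t) := by
      filter_upwards [hb] with t ht using (hΦω t ht).symm
    have h1 : DifferentiableAt ℂ ω 0 := hωd.differentiableAt hb
    have h2 : DifferentiableAt ℂ Φ (ω 0) := hΦ.differentiableAt (by rw [hω0]; exact hb)
    have h3 := hev.deriv_eq
    rw [show (fun t ↦ Φ (ω t)) = Φ ∘ ω from rfl, deriv_comp 0 h2 h1, h0, mul_zero,
      deriv_const_mul _ (hΨd.differentiableAt hb), hΨ1, mul_one] at h3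
    have : (c' : ℂ) ≠ 0 := by
      rw [hc']; exact_mod_cast (by positivity : (0 : ℝ) < (16 : ℝ) ^ ((N : ℝ)⁻¹)).ne'
    exact this h3
  set ψ : ℂ → ℂ := hωan.hasStrictDerivAt.localInverse ω (deriv ω 0) 0 hω'0 with hψ
  have hψan : AnalyticAt ℂ ψ 0 := by
    have h := hωan.analyticAt_localInverse hω'0
    rwa [hω0] at h
  have hleft : ∀ᶠ t in 𝓝 0, ψ (ω t) = t := hωan.hasStrictDerivAt.eventually_left_inverse hω'0
  have hright : ∀ᶠ z in 𝓝 0, ω (ψ z) = z := by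
    have h := hωan.hasStrictDerivAt.eventually_right_inverse hω'0
    rwa [hω0] at h
  have hψ0 : ψ 0 = 0 := by
    have h := HasStrictFDerivAt.localInverse_apply_image
      (hωan.hasStrictDerivAt.hasStrictFDerivAt_equiv hω'0)
    rw [hω0] at h
    exact h
  have hψt : Tendsto ψ (𝓝 0) (𝓝 0) := by simpa [ContinuousAt, hψ0] using hψan.continuousAt
  -- the scaled inverse `θ z = ψ (r z)`: analytic at `0`, `θ 0 = 0`
  set θ : ℂ → ℂ := fun z ↦ ψ ((r : ℂ) * z) with hθ
  have hlin : AnalyticAt ℂ (fun z : ℂ ↦ (r : ℂ) * z) 0 := analyticAt_const.mul analyticAt_id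
  have hlin0 : (fun z : ℂ ↦ (r : ℂ) * z) 0 = 0 := by simp
  have hθan : AnalyticAt ℂ θ 0 := by
    have : AnalyticAt ℂ ψ ((fun z : ℂ ↦ (r : ℂ) * z) 0) := by rw [hlin0]; exact hψan
    exact this.comp hlin
  have hθ0 : θ 0 = 0 := by simp [hθ, hψ0]
  have hθt : Tendsto θ (𝓝 0) (𝓝 0) := by simpa [ContinuousAt, hθ0] using hθan.continuousAt
  have hrt : Tendsto (fun z : ℂ ↦ (r : ℂ) * z) (𝓝 0) (𝓝 0) := by
    simpa [ContinuousAt] using hlin.continuousAt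
  -- near `0`: `φ = Ψ ∘ θ` and `g := y (r ·) = H ∘ θ`
  have hφ_eq : (fun z : ℂ ↦ (c : ℂ) * Φ ((r : ℂ) * z)) =ᶠ[𝓝 0] (Ψ ∘ θ) := by
    filter_upwards [hrt.eventually hright, hrt.eventually (hψt.eventually hb)] with z hz hzb
    simp only [Function.comp_apply, hθ]
    rw [← hz, hΦω _ hzb, ← mul_assoc, hcc', one_mul, hz]
  have hg_eq : (fun z : ℂ ↦ y ((r : ℂ) * z)) =ᶠ[𝓝 0] (H ∘ θ) := by
    filter_upwards [hrt.eventually hright, hrt.eventually (hψt.eventually hyω)] with z hz hzy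
    simp only [Function.comp_apply, hθ]
    rw [← hzy, hz]
  -- `g = y (r ·)` is analytic about the closed unit disc
  refine ⟨fun z ↦ y ((r : ℂ) * z), ?_, ?_⟩
  · have h := Literature.NumberTheory.Automorphic.analyticOnNhd_holonomyMap (c := (1 : ℝ)) hyd hr0.le hr1
    have he : (fun z : ℂ ↦ ((1 : ℝ) : ℂ) * y ((r : ℂ) * z)) = fun z ↦ y ((r : ℂ) * z) := by
      funext z; rw [Complex.ofReal_one, one_mul]
    rwa [he] at h
  -- the formal identity
  have hTΨ : PowerSeries.mk (fun n ↦ iteratedDeriv n Ψ 0 / n.factorial) = x.map (algebraMap ℚ ℂ) :=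
    taylorPowerSeries_root_eq_map_formal_root hN.ne' hΨd hΨ0 hΨ1 hΨpow hL hx0 hx1 hxN
  set S : PowerSeries ℂ := PowerSeries.mk (fun n ↦ iteratedDeriv n θ 0 / n.factorial) with hS
  have hS0 : PowerSeries.constantCoeff S = 0 := by rw [hS, constantCoeff_taylorPowerSeries, hθ0]
  have hsS : PowerSeries.HasSubst S := PowerSeries.HasSubst.of_constantCoeff_zero' hS0
  have hX0 : PowerSeries.constantCoeff (x.map (algebraMap ℚ ℂ)) = 0 := by
    rw [← PowerSeries.coeff_zero_eq_constantCoeff_apply, PowerSeries.coeff_map,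
      PowerSeries.coeff_zero_eq_constantCoeff_apply, hx0, map_zero]
  have hsX : PowerSeries.HasSubst (x.map (algebraMap ℚ ℂ)) :=
    PowerSeries.HasSubst.of_constantCoeff_zero' hX0
  calc (f.map (algebraMap ℚ ℂ)).subst (PowerSeries.mk fun n ↦
          iteratedDeriv n (fun z : ℂ ↦ (c : ℂ) * Φ ((r : ℂ) * z)) 0 / n.factorial)
      = (f.map (algebraMap ℚ ℂ)).subst (PowerSeries.mk fun n ↦ iteratedDeriv n (Ψ ∘ θ) 0 / n.factorial) := by
        rw [taylorPowerSeries_congr hφ_eq]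
    _ = (f.map (algebraMap ℚ ℂ)).subst ((x.map (algebraMap ℚ ℂ)).subst S) := by
        rw [taylorPowerSeries_comp hΨan hθan hθ0, hTΨ]
    _ = PowerSeries.subst S ((f.map (algebraMap ℚ ℂ)).subst (x.map (algebraMap ℚ ℂ))) :=
        (PowerSeries.subst_comp_subst_apply hsX hsS _).symm
    _ = PowerSeries.subst S (PowerSeries.mk fun n ↦ iteratedDeriv n H 0 / n.factorial) := by rw [hfH]
    _ = PowerSeries.mk fun n ↦ iteratedDeriv n (H ∘ θ) 0 / n.factorial :=
        (taylorPowerSeries_comp hHan hθan hθ0).symm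
    _ = PowerSeries.mk fun n ↦ iteratedDeriv n (fun z : ℂ ↦ y ((r : ℂ) * z)) 0 / n.factorial :=
        (taylorPowerSeries_congr hg_eq).symm

end Literature.Analysis.Complex

end
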